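import Summits.BirchSwinnertonDyer.BirchSwinnertonDyer.Theorems.ThetaPartnerAtTwoSignedMainConjectureCMTwoRankZeroLengthDoors
import Summits.BirchSwinnertonDyer.BirchSwinnertonDyer.Theorems.ThetaPartnerAtTwoSignedMainConjectureCMTwoRankZeroFourTermLengthEq
import HarnessLib

/-!
# Route `ThetaPartnerAtTwo` (TP2), crux K2r0P `SignedMainConjectureCMTwoRankZeroOfPub` (stmt-BirchSwinnertonDyer-24945),
# line `rankzero` v14: the CM PACKAGE DOORS — the registered stub (LD±2^k)_A and the promote text D_MC from ONE displayed
# «four-term package at 2» per dual datum and height-one prime `𝔭 ∌ 2` (the CM twin of the K3 seats' localised package road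
# `SignedKatoOffTwo.signedKatoDivisibilityUpToAtTwo_of_localRobustPackageTwo_of_pub`, in EQUALITY / LOWER form)

HONEST FRAMING (cell `pub/bsd-wall`, W-ALL row 1, lead prover `bsd-wall-tp2-p2` g8, 2026-08-28). THEOREMS ONLY; nothing about any curve is
asserted; the displayed package is a HYPOTHESIS — the research content of the port (Kato route (P1)–(P4), cell memo
`Cruxes/…/ER2-PRINT-SOURCE-w2.md` §5): for the CM partner `A` at `2`, per dual datum `D` of `Sel⁺(A/ℚ_∞)` and height-one `𝔭 ∌ 2`, modules
and maps `H →ᶜ P →ʲ X⁺ →ᵏ Y` with `ι : P ↪ Λ` (Iwasawa `𝐇¹`, the `+` Coleman module, the fine dual; Kobayashi (7.17)–(7.21) / Kato §17.13 at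
`p = 2`), a class `z ∈ H` (the image of the elliptic / Kato zeta element), and
* LOWER package: `c` injective, `k ∘ j = 0`, `ker j ≤ range c` (the DEEP half of Poitou–Tate), `k` onto, the `+` Coleman cokernel invisible at
  `𝔭`, `ℓ_𝔭(Y) < ⊤`, the K-side inequality in the ELLIPTIC-UNIT direction `ℓ_𝔭(H/Λz) ≤ ℓ_𝔭(Y)` (the half of Johnson-Leung–Kings 2011 Thm. 5.2
  that Kato's Euler-system bound does not give; Kato Lemma 15.13 away from `(2)`), and the reciprocity comparison
  `ℓ_𝔭(Λ/(ι c z)) = ℓ_𝔭(Λ/(L♭))` (Kato Prop. 15.9 / (15.12.2) + interpolation) ⟹ the REGISTERED stub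
  `stub_signedLowerDivisibilityUpToTwoPowerNonUnitCMTwo` VERBATIM (`signedLowerDivisibilityUpToTwoPowerNonUnitCMTwo_of_cmPackageLe`);
* EXACT package: `c` injective, `H →ᶜ P →ʲ X⁺ →ᵏ Y → 0` exact, cokernel invisible, `ℓ_𝔭(H/Λz) < ⊤`, the K-side EQUALITY
  `ℓ_𝔭(Y) = ℓ_𝔭(H/Λz)`, the comparison ⟹ D_MC in «∃ one datum» form (`signedUpToTwoPowerNonUnitCMTwo_exists_of_cmPackageEq`) and, with
  PUB¹⁰ + (μ♭)_A, the crux BODY (`signedMainConjectureCMTwoRankZero_body_of_pub_of_cmPackageEq_of_flat`).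
Compared with the K3 (non-CM) package: the CM port needs the COMPLEMENTARY exactness halves (complex at `X⁺`, deep inclusion at `P`) and a
K-side (in)equality INSTEAD of Kato's Thm. 13.4 (2) — and no `¬ HasCM`. BSD is not proved by any of this.

References: [Kato2004Asterisque] Prop. 15.9 (p. 258), Lemma 15.13 (p. 264), §17.13 (p. 280); [JohnsonLeungKings2011] Thm. 5.2;
[Kobayashi2003] Thm. 1.3 (p. 2), (7.17)–(7.21), Thm. 7.3 (pp. 12–13); [PollackRubin2004] Thm. 7.3 (p > 2).
-/

set_option autoImplicit false
-- the Theorems namespace of this sub repeats the summit name by design (D-0017 nested layout)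
set_option linter.dupNamespace false

noncomputable section

open scoped Classical MatrixGroups ModularForm

open CongruenceSubgroup WeierstrassCurve Literature.NumberTheory.EllipticCurves
  Literature.NumberTheory.EllipticCurves.ModularForms Literature.NumberTheory.EllipticCurves.Module
  Literature.NumberTheory.EllipticCurves.Rank1Residual
  Literature.NumberTheory.EllipticCurves.Kobayashi2003 ZpExtension
  Summit.BirchSwinnertonDyer.Rank1Residual.Supersingular

namespace Summit.BirchSwinnertonDyer.BirchSwinnertonDyer.Theorems

namespace SignedLengthDoors

/-- **The REGISTERED stub (LD±2^k)_A VERBATIM from the LOWER CM package at `2`.** For every class member off the unit zone, every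
normalised cyclotomic datum and newform: ONE period ratio, ONE Pollack pair at `2`, and for every dual datum `D` of `Sel⁺(A/ℚ_∞)`
(torsion) and every height-one `𝔭 ∌ 2` a four-term LOWER package `H →ᶜ P →ʲ X⁺ →ᵏ Y`, `ι : P ↪ Λ`, `z ∈ H` (see the module docstring) with
`ℓ_𝔭(H/Λz) ≤ ℓ_𝔭(Y)` and `ℓ_𝔭(Λ/(ι c z)) = ℓ_𝔭(Λ/(L♭))`. Then `stub_signedLowerDivisibilityUpToTwoPowerNonUnitCMTwo` holds
(`lengthAt_quotient_span_le_of_fourTerm` + `signedLowerDivisibilityUpToTwoPowerNonUnitCMTwo_of_lengthLe`).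
[cite: Kobayashi2003, Thm. 1.3 (i) (p. 2), (7.17)–(7.21)] [cite: Kato2004Asterisque, Lemma 15.13 (p. 264), §17.13 (p. 280)]
[cite: JohnsonLeungKings2011, Thm. 5.2] -/
theorem signedLowerDivisibilityUpToTwoPowerNonUnitCMTwo_of_cmPackageLe
    (h : ∀ (A : WeierstrassCurve ℚ) [A.IsElliptic] [A.IsGloballyMinimal],
      A.HasCM → A.analyticRank = 0 → GoodSS A 2 → A.frobeniusTrace 2 = 0 →
      2 ∣ A.shaOrder * A.tamagawaProduct →
      ∀ (κ : ZpExtension ℚ 2) (γ : Field.absoluteGaloisGroup ℚ),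
        κ.IsCyclotomic → κ.IsTopGenerator γ → IsCyclotomicVariable 2 γ →
      ∀ [NeZero (A.conductorNorm ℤ)] (f : CuspForm (Gamma0 (A.conductorNorm ℤ)) 2), IsNewformOf A f →
      ∃ (ϖ : ℚ) (Lplus Lminus : IwasawaAlgebra 2), (ϖ : ℝ) * A.realPeriodRat = plusPeriod f ∧
        IsPollackPair f 2 Lplus Lminus ∧
        ∀ (D : SignedSelmerDualData A κ γ 1), Module.IsTorsion (IwasawaAlgebra 2) D.X ∧
          ∀ 𝔭 : PrimeSpectrum (IwasawaAlgebra 2), 𝔭.asIdeal.height = 1 →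
            PowerSeries.C (2 : ℤ_[2]) ∉ 𝔭.asIdeal →
          ∃ (H P Y : Type) (_ : AddCommGroup H) (_ : Module (IwasawaAlgebra 2) H)
            (_ : AddCommGroup P) (_ : Module (IwasawaAlgebra 2) P) (_ : AddCommGroup Y) (_ : Module (IwasawaAlgebra 2) Y)
            (ι : P →ₗ[IwasawaAlgebra 2] IwasawaAlgebra 2) (c : H →ₗ[IwasawaAlgebra 2] P)
            (j : P →ₗ[IwasawaAlgebra 2] D.X) (k : D.X →ₗ[IwasawaAlgebra 2] Y) (z : H),
            Function.Injective ι ∧ Function.Injective c ∧ (∀ x, k (j x) = 0) ∧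
            LinearMap.ker j ≤ LinearMap.range c ∧ Function.Surjective k ∧
            lengthAt (IwasawaAlgebra 2) (IwasawaAlgebra 2 ⧸ LinearMap.range ι) 𝔭 = 0 ∧
            lengthAt (IwasawaAlgebra 2) Y 𝔭 ≠ ⊤ ∧
            lengthAt (IwasawaAlgebra 2) (H ⧸ Submodule.span (IwasawaAlgebra 2) {z}) 𝔭 ≤ lengthAt (IwasawaAlgebra 2) Y 𝔭 ∧
            lengthAt (IwasawaAlgebra 2) (IwasawaAlgebra 2 ⧸ Ideal.span {ι (c z)}) 𝔭 =
              lengthAt (IwasawaAlgebra 2) (IwasawaAlgebra 2 ⧸ Ideal.span {kobayashiL 1 Lplus Lminus}) 𝔭) :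
    ∀ (A : WeierstrassCurve ℚ) [A.IsElliptic] [A.IsGloballyMinimal],
      A.HasCM → A.analyticRank = 0 → GoodSS A 2 → A.frobeniusTrace 2 = 0 →
      2 ∣ A.shaOrder * A.tamagawaProduct →
      ∀ (κ : ZpExtension ℚ 2) (γ : Field.absoluteGaloisGroup ℚ),
        κ.IsCyclotomic → κ.IsTopGenerator γ → IsCyclotomicVariable 2 γ →
      ∀ [NeZero (A.conductorNorm ℤ)] (f : CuspForm (Gamma0 (A.conductorNorm ℤ)) 2),
        IsNewformOf A f → ∀ (ϖ : ℚ), (ϖ : ℝ) * A.realPeriodRat = plusPeriod f →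
      ∀ (Lplus Lminus : IwasawaAlgebra 2), IsPollackPair f 2 Lplus Lminus →
      ∀ (D : SignedSelmerDualData A κ γ 1),
        ∃ (g h : IwasawaAlgebra 2) (m m' : ℕ), D.charIdeal = Ideal.span {g} ∧
          PowerSeries.C ((2 : ℚ_[2]) ^ m') * iwasawaToPowerSeries 2 g =
            PowerSeries.C ((2 : ℚ_[2]) ^ m * (ϖ : ℚ_[2])) * iwasawaToPowerSeries 2 (kobayashiL 1 Lplus Lminus * h) := by
  refine signedLowerDivisibilityUpToTwoPowerNonUnitCMTwo_of_lengthLe fun A _ _ hcm hr hss ha hz κ γ hκ hγ hcv _ f hf ↦ ?_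
  obtain ⟨ϖ, Lplus, Lminus, hϖ, hPP, hD⟩ := h A hcm hr hss ha hz κ γ hκ hγ hcv f hf
  refine ⟨ϖ, Lplus, Lminus, hϖ, hPP, fun D ↦ ⟨(hD D).1, fun 𝔭 h𝔭 hp𝔭 ↦ ?_⟩⟩
  obtain ⟨H, P, Y, _, _, _, _, _, _, ι, c, j, k, z, hι, hc, hkj, hker, hk, hcoker, hfinY, hglob, hL⟩ := (hD D).2 𝔭 h𝔭 hp𝔭
  exact lengthAt_quotient_span_le_of_fourTerm ι hι c hc j k hkj hker hk z 𝔭 hcoker hfinY hglob hL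

/-- **D_MC («∃ one datum» form, the hypothesis of `signedUpToTwoPowerNonUnitCMTwo_of_exists`) from the EXACT CM package at `2`.**
As above with `H →ᶜ P →ʲ X⁺ →ᵏ Y → 0` EXACT, `ℓ_𝔭(H/Λz) < ⊤` and the K-side EQUALITY `ℓ_𝔭(Y) = ℓ_𝔭(H/Λz)` (Johnson-Leung–Kings 2011 Thm. 5.2
transported by Kato Lemma 15.13 at `𝔭 ∌ 2`). [cite: JohnsonLeungKings2011, Thm. 5.2] [cite: Kato2004Asterisque, Lemma 15.13 (p. 264), §17.13 (p. 280)]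
[cite: PollackRubin2004, Thm. 7.3 (p > 2)] -/
theorem signedUpToTwoPowerNonUnitCMTwo_exists_of_cmPackageEq
    (h : ∀ (A : WeierstrassCurve ℚ) [A.IsElliptic] [A.IsGloballyMinimal],
      A.HasCM → A.analyticRank = 0 → GoodSS A 2 → A.frobeniusTrace 2 = 0 →
      2 ∣ A.shaOrder * A.tamagawaProduct →
      ∀ (κ : ZpExtension ℚ 2) (γ : Field.absoluteGaloisGroup ℚ),
        κ.IsCyclotomic → κ.IsTopGenerator γ → IsCyclotomicVariable 2 γ →
      ∀ [NeZero (A.conductorNorm ℤ)] (f : CuspForm (Gamma0 (A.conductorNorm ℤ)) 2), IsNewformOf A f →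
      ∃ (ϖ : ℚ) (Lplus Lminus : IwasawaAlgebra 2), (ϖ : ℝ) * A.realPeriodRat = plusPeriod f ∧
        IsPollackPair f 2 Lplus Lminus ∧
        ∀ (D : SignedSelmerDualData A κ γ 1), Module.IsTorsion (IwasawaAlgebra 2) D.X ∧
          ∀ 𝔭 : PrimeSpectrum (IwasawaAlgebra 2), 𝔭.asIdeal.height = 1 →
            PowerSeries.C (2 : ℤ_[2]) ∉ 𝔭.asIdeal →
          ∃ (H P Y : Type) (_ : AddCommGroup H) (_ : Module (IwasawaAlgebra 2) H)
            (_ : AddCommGroup P) (_ : Module (IwasawaAlgebra 2) P) (_ : AddCommGroup Y) (_ : Module (IwasawaAlgebra 2) Y)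
            (ι : P →ₗ[IwasawaAlgebra 2] IwasawaAlgebra 2) (c : H →ₗ[IwasawaAlgebra 2] P)
            (j : P →ₗ[IwasawaAlgebra 2] D.X) (k : D.X →ₗ[IwasawaAlgebra 2] Y) (z : H),
            Function.Injective ι ∧ Function.Injective c ∧ Function.Exact c j ∧ Function.Exact j k ∧ Function.Surjective k ∧
            lengthAt (IwasawaAlgebra 2) (IwasawaAlgebra 2 ⧸ LinearMap.range ι) 𝔭 = 0 ∧
            lengthAt (IwasawaAlgebra 2) (H ⧸ Submodule.span (IwasawaAlgebra 2) {z}) 𝔭 ≠ ⊤ ∧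
            lengthAt (IwasawaAlgebra 2) Y 𝔭 = lengthAt (IwasawaAlgebra 2) (H ⧸ Submodule.span (IwasawaAlgebra 2) {z}) 𝔭 ∧
            lengthAt (IwasawaAlgebra 2) (IwasawaAlgebra 2 ⧸ Ideal.span {ι (c z)}) 𝔭 =
              lengthAt (IwasawaAlgebra 2) (IwasawaAlgebra 2 ⧸ Ideal.span {kobayashiL 1 Lplus Lminus}) 𝔭) :
    ∀ (A : WeierstrassCurve ℚ) [A.IsElliptic] [A.IsGloballyMinimal],
      A.HasCM → A.analyticRank = 0 → GoodSS A 2 → A.frobeniusTrace 2 = 0 →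
      2 ∣ A.shaOrder * A.tamagawaProduct →
      ∀ (κ : ZpExtension ℚ 2) (γ : Field.absoluteGaloisGroup ℚ),
        κ.IsCyclotomic → κ.IsTopGenerator γ → IsCyclotomicVariable 2 γ →
      ∀ [NeZero (A.conductorNorm ℤ)] (f : CuspForm (Gamma0 (A.conductorNorm ℤ)) 2), IsNewformOf A f →
      ∃ (ϖ : ℚ) (Lplus Lminus : IwasawaAlgebra 2), (ϖ : ℝ) * A.realPeriodRat = plusPeriod f ∧
        IsPollackPair f 2 Lplus Lminus ∧
        ∀ (D : SignedSelmerDualData A κ γ 1),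
          ∃ (g : IwasawaAlgebra 2) (m m' : ℕ), D.charIdeal = Ideal.span {g} ∧
            PowerSeries.C ((2 : ℚ_[2]) ^ m') * iwasawaToPowerSeries 2 g =
              PowerSeries.C ((2 : ℚ_[2]) ^ m * (ϖ : ℚ_[2])) * iwasawaToPowerSeries 2 (kobayashiL 1 Lplus Lminus) := by
  refine signedUpToTwoPowerNonUnitCMTwo_exists_of_lengthEq fun A _ _ hcm hr hss ha hz κ γ hκ hγ hcv _ f hf ↦ ?_
  obtain ⟨ϖ, Lplus, Lminus, hϖ, hPP, hD⟩ := h A hcm hr hss ha hz κ γ hκ hγ hcv f hf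
  refine ⟨ϖ, Lplus, Lminus, hϖ, hPP, fun D ↦ ⟨(hD D).1, fun 𝔭 h𝔭 hp𝔭 ↦ ?_⟩⟩
  obtain ⟨H, P, Y, _, _, _, _, _, _, ι, c, j, k, z, hι, hc, hcj, hjk, hk, hcoker, hfin, hglob, hL⟩ := (hD D).2 𝔭 h𝔭 hp𝔭
  exact lengthAt_eq_quotient_span_of_fourTerm ι hι c hc j k hcj hjk hk z 𝔭 hcoker hfin hglob hL

/-- **The crux BODY from PUB¹⁰ + the EXACT CM package at `2` + (μ♭)_A** (through `…_exists_of_cmPackageEq`, the uniqueness door and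
`signedMainConjectureCMTwoRankZero_body_of_pub_of_upToTwoPower_of_flat`). The two displayed research binders: the package (a PORT of print —
Kato 2004 §15 + JLK 2011) and the registered (μ♭)_A (open class-wide). [cite: Kato2004Asterisque, Prop. 15.9 (p. 258), Lemma 15.13 (p. 264)]
[cite: JohnsonLeungKings2011, Thm. 5.2] [cite: BurungaleFlach2024, Thm. 1.1] [cite: PollackRubin2004, Thm. 7.3 (p > 2)] -/
theorem signedMainConjectureCMTwoRankZero_body_of_pub_of_cmPackageEq_of_flat
    (hBF : bsdTriple_of_hasCM_of_L_one_ne_zero)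
    (hmod : nonempty_modularParametrizationData) (hLrat : hasEntireLFunction_rat)
    (hGZK : rank_eq_analyticRank_of_analyticRank_le_one)
    (h2 : Literature.NumberTheory.EllipticCurves.realPeriodRat_eq_unit_mul_plusPeriod_two)
    (hC : Greenberg1999.casselsSurjectivity_H1Sigma ℚ)
    (h412 : Greenberg1999.prop412_noFiniteSubmodule_H1Sigma_of_rank_one)
    (hcork : Greenberg1999.h1Sigma_zpCorank_le_degree ℚ)
    (hP108 : Greenberg1999.localQuotient_restriction_surjective ℚ)
    (hWL : Greenberg1999.h1SigmaInfty_rank_eq_one)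
    (hpkg : ∀ (A : WeierstrassCurve ℚ) [A.IsElliptic] [A.IsGloballyMinimal],
      A.HasCM → A.analyticRank = 0 → GoodSS A 2 → A.frobeniusTrace 2 = 0 →
      2 ∣ A.shaOrder * A.tamagawaProduct →
      ∀ (κ : ZpExtension ℚ 2) (γ : Field.absoluteGaloisGroup ℚ),
        κ.IsCyclotomic → κ.IsTopGenerator γ → IsCyclotomicVariable 2 γ →
      ∀ [NeZero (A.conductorNorm ℤ)] (f : CuspForm (Gamma0 (A.conductorNorm ℤ)) 2), IsNewformOf A f →
      ∃ (ϖ : ℚ) (Lplus Lminus : IwasawaAlgebra 2), (ϖ : ℝ) * A.realPeriodRat = plusPeriod f ∧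
        IsPollackPair f 2 Lplus Lminus ∧
        ∀ (D : SignedSelmerDualData A κ γ 1), Module.IsTorsion (IwasawaAlgebra 2) D.X ∧
          ∀ 𝔭 : PrimeSpectrum (IwasawaAlgebra 2), 𝔭.asIdeal.height = 1 →
            PowerSeries.C (2 : ℤ_[2]) ∉ 𝔭.asIdeal →
          ∃ (H P Y : Type) (_ : AddCommGroup H) (_ : Module (IwasawaAlgebra 2) H)
            (_ : AddCommGroup P) (_ : Module (IwasawaAlgebra 2) P) (_ : AddCommGroup Y) (_ : Module (IwasawaAlgebra 2) Y)
            (ι : P →ₗ[IwasawaAlgebra 2] IwasawaAlgebra 2) (c : H →ₗ[IwasawaAlgebra 2] P)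
            (j : P →ₗ[IwasawaAlgebra 2] D.X) (k : D.X →ₗ[IwasawaAlgebra 2] Y) (z : H),
            Function.Injective ι ∧ Function.Injective c ∧ Function.Exact c j ∧ Function.Exact j k ∧ Function.Surjective k ∧
            lengthAt (IwasawaAlgebra 2) (IwasawaAlgebra 2 ⧸ LinearMap.range ι) 𝔭 = 0 ∧
            lengthAt (IwasawaAlgebra 2) (H ⧸ Submodule.span (IwasawaAlgebra 2) {z}) 𝔭 ≠ ⊤ ∧
            lengthAt (IwasawaAlgebra 2) Y 𝔭 = lengthAt (IwasawaAlgebra 2) (H ⧸ Submodule.span (IwasawaAlgebra 2) {z}) 𝔭 ∧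
            lengthAt (IwasawaAlgebra 2) (IwasawaAlgebra 2 ⧸ Ideal.span {ι (c z)}) 𝔭 =
              lengthAt (IwasawaAlgebra 2) (IwasawaAlgebra 2 ⧸ Ideal.span {kobayashiL 1 Lplus Lminus}) 𝔭)
    (hμ : ∀ (A : WeierstrassCurve ℚ) [A.IsElliptic] [A.IsGloballyMinimal],
      A.HasCM → A.analyticRank = 0 → GoodSS A 2 → A.frobeniusTrace 2 = 0 →
      2 ∣ A.shaOrder * A.tamagawaProduct →
      ∀ [NeZero (A.conductorNorm ℤ)] (f : CuspForm (Gamma0 (A.conductorNorm ℤ)) 2),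
      IsNewformOf A f → ∀ (Lplus Lminus : IwasawaAlgebra 2), IsPollackPair f 2 Lplus Lminus →
        ∃ n : ℕ, IsUnit (PowerSeries.coeff n (kobayashiL 1 Lplus Lminus)))
    (A : WeierstrassCurve ℚ) [A.IsElliptic] [A.IsGloballyMinimal]
    (hcm : A.HasCM) (hr : A.analyticRank = 0) (hss : GoodSS A 2) (ha : A.frobeniusTrace 2 = 0) :
    (∀ (κ : ZpExtension ℚ 2) (γ : Field.absoluteGaloisGroup ℚ), κ.IsCyclotomic → κ.IsTopGenerator γ →
      ∀ D : SignedSelmerDualData A κ γ 1, Module.IsTorsion (IwasawaAlgebra 2) D.X ∧ D.mu = 0) ∧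
    KobayashiMainConjecture A 2 1 :=
  signedMainConjectureCMTwoRankZero_body_of_pub_of_upToTwoPower_of_flat hBF hmod hLrat hGZK h2 hC h412 hcork hP108 hWL
    (signedUpToTwoPowerNonUnitCMTwo_of_exists (signedUpToTwoPowerNonUnitCMTwo_exists_of_cmPackageEq hpkg)) hμ A hcm hr hss ha

end SignedLengthDoors

end Summit.BirchSwinnertonDyer.BirchSwinnertonDyer.Theorems

end
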